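import Mathlib.CategoryTheory.Action.Concrete
import Literature.IUT.HodgeTheaters.ThetaHodgeTheatersRemarksB
import HarnessLib

/-!
# [IUTchI] Remark 3.8.1 (iii): `B(G)` sees `G` EXACTLY up to inner automorphisms

S. Mochizuki, *Inter-universal Teichmüller theory I*, §3, Remark 3.8.1 (iii), kurims manuscript
(May 2020) p. 90 [claim: Mochizuki2012, status: disputed]: "`⁽⁻⁾𝒟⊢_v` is simply the category of
connected objects of the Galois category associated to the profinite group `G_v`.  That is to say,
one may think of `⁽⁻⁾𝒟⊢_v` as representing "`G_v` up to isomorphism" … the quotients corresponding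
to `G_v` of the copies of `Π_v` … are only related to one another via some indeterminate
isomorphism."

`ThetaHodgeTheatersRemarksB.lean` (FROZEN) proves one half of the group-theoretic kernel: restriction
of `G`-objects along an INNER automorphism is isomorphic to the identity functor
(`EtalePictureGroupoid.resConjIso`).  This companion proves the CONVERSE on `G`-sets: if restriction
along an automorphism `α` of `G` is isomorphic to the identity functor of `G`-sets, then `α` is
inner (`exists_conj_of_res_iso_id`; test the natural isomorphism on the regular `G`-set and use its
naturality with respect to right multiplications).  Together (`res_iso_id_iff_inner`): the category
of `G`-sets — hence the Galois category `B(G)` and the étale-picture's coric `𝒟⊢_v = B(G_v)⁰` —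
detects an automorphism of `G` EXACTLY up to inner automorphisms, i.e. "`G_v` up to (indeterminate)
isomorphism" costs precisely the conjugacy indeterminacy and nothing more.  Elementary; nothing of
the disputed series is asserted.
-/

namespace Literature.IUT.HodgeTheaters

open CategoryTheory

universe u

namespace EtalePictureGroupoid

variable (G : Type u) [Group G]

/-- Right multiplication by `k`: an endomorphism of the left-regular `G`-set `G` (the `G`-set
`G ↷ G` whose `G`-endomorphisms are exactly the right multiplications).
[claim: Mochizuki2012, status: disputed] -/
def rightMul (k : G) : Action.leftRegular G ⟶ Action.leftRegular G where
  hom := TypeCat.ofHom (fun x : G => x * k)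
  comm h := by
    ext x
    exact mul_assoc h x k

/-- `rightMul k` is `x ↦ x·k` on underlying elements. [claim: Mochizuki2012, status: disputed] -/
theorem rightMul_apply (k y : G) : (ConcreteCategory.hom (rightMul G k).hom) y = y * k := rfl

/-- **Rmk 3.8.1 (iii), converse half of the kernel**: if restriction of `G`-sets along an
automorphism `α` of `G` is naturally isomorphic to the identity functor, then `α` is INNER.  Proof:
the component of the natural isomorphism at the regular `G`-set is a map `η : G → G` with
`η(h·x) = α(h)·η(x)`; naturality with respect to the right multiplications gives `η(x·k) = η(x)·k`;
hence `α(h)·η(1) = η(h) = η(1)·h`. PROVED. [claim: Mochizuki2012, status: disputed] -/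
theorem exists_conj_of_res_iso_id (α : G ≃* G)
    (e : Action.res (Type u) α.toMonoidHom ≅ 𝟭 (Action (Type u) G)) :
    ∃ g : G, ∀ h : G, α h = g * h * g⁻¹ := by
  set R := Action.leftRegular G with hRdef
  let η : R ⟶ (Action.res (Type u) α.toMonoidHom).obj R := e.inv.app R
  let f : G → G := fun x => η.hom x
  have hη : ∀ h x : G, f (h * x) = α h * f x := by
    intro h x
    have h0 := congrArg (fun φ => φ x) (η.comm h)
    exact h0
  have hR : ∀ k x : G, f (x * k) = f x * k := by
    intro k x
    have h0 := e.inv.naturality (rightMul G k)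
    dsimp only [Functor.id_obj, Functor.id_map] at h0
    have h1 := congrArg (fun φ => φ.hom x) h0
    simp only [Action.comp_hom, Action.res_map_hom, types_comp_apply] at h1
    have h2 : f (x * k) = (rightMul G k).hom (η.hom x) := h1
    exact h2.trans (rightMul_apply G k (η.hom x))
  refine ⟨f 1, fun h => ?_⟩
  have h1 : f h = α h * f 1 := by simpa using hη h 1
  have h2 : f h = f 1 * h := by simpa using hR h 1
  rw [eq_mul_inv_iff_mul_eq, ← h2, h1]

/-- **Rmk 3.8.1 (iii), the kernel in final form**: restriction of `G`-sets along an automorphism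
`α` of `G` is isomorphic to the identity functor IF AND ONLY IF `α` is inner — the category of
`G`-sets (so the Galois category `B(G)`, and `𝒟⊢_v = B(G_v)⁰`) represents "`G` up to isomorphism"
with exactly the conjugacy indeterminacy (forward half: `resConjIso` of
`ThetaHodgeTheatersRemarksB.lean`). PROVED. [claim: Mochizuki2012, status: disputed] -/
theorem res_iso_id_iff_inner (α : G ≃* G) :
    Nonempty (Action.res (Type u) α.toMonoidHom ≅ 𝟭 (Action (Type u) G)) ↔
      ∃ g : G, ∀ h : G, α h = g * h * g⁻¹ := by
  constructor
  · rintro ⟨e⟩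
    exact exists_conj_of_res_iso_id G α e
  · rintro ⟨g, hg⟩
    have hα : α.toMonoidHom = (MulAut.conj g).toMonoidHom := by
      ext h
      simpa [MulAut.conj_apply] using hg h
    exact ⟨Action.resCongr (Type u) hα ≪≫ resConjIso (Type u) G g⟩

end EtalePictureGroupoid

end Literature.IUT.HodgeTheaters
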